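import Summits.ResolutionOfSingularities.ResolutionOfSingularities.Theorems.EquisingularLiftEquisingularLiftOfElnatO
import HarnessLib

/-!
# EL / EL♮ / EL♮(3) — THE RESIDUAL IS FINITELY MANY CHARACTERISTICS PER DEGREE: the three route decls BY NAME from `ELNatConclusionO` at
# non-regular prime-form hypersurfaces of degree `e ≥ 2` in `ℙⁿ` (`n ≥ 3`) in characteristics `p ≤ M(n, e)` only

leafhand-res-equisingularlift-6 g0 (prover, 2026-08-31; one-generation line-first hand on stmt-ResolutionOfSingularities-15660 / -20038 / -20148,
cell `pub/decomp-res`).  DEF-FREE; no `sorry`; standard axioms; ZERO named hypotheses; `--supports stmt-ResolutionOfSingularities-20148 --as helper`,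
counted 0.  Sequel of …NatRouteCurrency (bridge `elNatAt_of_elnatO`, doors `equisingularLiftNat(Three)_of_forall_elnatO_primeForms`, this hand) and
…OfElnatO (`elConclusion_of_elnatO`, this hand) over RUNG LC ✓ `LargeChar.elnat_largeChar` (leafhand-4) and the dictionary
✓ `LargeChar.two_le_and_exists_prime_form_of_not_isRegular` (leafhand-5).

Let `M(n, e) := Classical.choose (LargeChar.elnat_largeChar n e)` — the (ineffective, degree-dependent) bound of RUNG LC: for primes `p > M(n, e)` the
stubs' conclusion `ELNatConclusionO k n H ι` holds for every integral `H` with `range ι = V₊(F)`, `F ≠ 0` of degree `e`.  Hence: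

* ★★ `equisingularLiftNat_of_forall_elnatO_smallChar` — `Theses.EquisingularLift.EquisingularLiftNat` (stmt-…-20038) holds BY NAME as soon as
  `ELNatConclusionO k n H ι` is known for every `n ≥ 3`, every degree `e ≥ 2`, every prime `p ≤ M(n, e)`, and every NON-REGULAR integral `H` with
  `range ι = V₊(F)`, `F` PRIME of degree `e` (crux hypotheses);
* ★★ `equisingularLiftNatThree_of_forall_elnatO_smallChar` — `Theses.EquisingularLift.EquisingularLiftNatThree` (stmt-…-20148) likewise from the
  NON-REGULAR integral SURFACES of degree `e ≥ 2` in `ℙ³` in characteristics `p ≤ M(3, e)`;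
* ★★ `equisingularLift_of_forall_elnatO_smallChar` — `Theses.EquisingularLift.EquisingularLift` (stmt-…-15660) from the same hypothesis as the first
  (EL♮ ⇒ EL per instance, ✓ `EquisingularLiftNatBands.elConclusion_of_natConclusion`).

HONEST READING: reductions only — for each `(n, e)` the finitely many characteristics `p ≤ M(n, e)` are EXACTLY where the research residues live, and
`M` is INEFFECTIVE (Noetherian induction in ✓ `exists_bound_forall_prime_of_generic`), so no single characteristic is thereby excluded; EL / EL♮ /
EL♮(3) are NOT proved; no registered stub is closed; resolution of singularities in positive characteristic is NOT proved; nothing of [Hironaka2017]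
(a candidate under adjudication) is asserted or used.  AI-written; AI review is weaker than expert review.
[cite: Grothendieck1966, EGA IV₃ §8–§9] (method; index only)
-/

set_option linter.dupNamespace false -- mandated namespace `Summit.<Summit>.<Problem>` of this single-conjunct summit

noncomputable section

open CategoryTheory CategoryTheory.Limits AlgebraicGeometry TopologicalSpace Topology
open MvPolynomial HomogeneousIdeal
open Literature.AlgebraicGeometry.Resolution Literature.AlgebraicGeometry.Motives
open Summit.ResolutionOfSingularities.ResolutionOfSingularities.Theorems
open Summit.ResolutionOfSingularities.ResolutionOfSingularities.Theorems.EquisingularLift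

namespace Summit.ResolutionOfSingularities.ResolutionOfSingularities.Cruxes.EquisingularLiftNat.Sections

namespace RouteCurrency

/-- ★★ **`Theses.EquisingularLift.EquisingularLiftNat` (stmt-…-20038): PER DEGREE, ONLY FINITELY MANY CHARACTERISTICS REMAIN.**  Let
`M(n, e) := Classical.choose (LargeChar.elnat_largeChar n e)` be the (ineffective) bound of RUNG LC.  If for every `n ≥ 3`, every degree `e ≥ 2`,
every prime `p ≤ M(n, e)`, every algebraically closed `k` of characteristic `p` and every instance `(H, ι)` of the crux hypotheses with `H` NOT regular
and `range ι = V₊(F)`, `F` a PRIME form of degree `e`, the stubs' conclusion `ELNatConclusionO k n H ι` holds — then the route decl holds BY NAME: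
characteristics `p > M(n, e)` are ✓ `LargeChar.elnat_largeChar` (`Classical.choose_spec`), and the rest is ✓ `equisingularLiftNat_of_forall_elnatO_primeForms`.
[OURS · DEF-FREE · pure reduction over ✓ RUNG LC; `M` ineffective] -/
theorem equisingularLiftNat_of_forall_elnatO_smallChar
    (h : ∀ (n e : ℕ), 3 ≤ n → 2 ≤ e → ∀ p : ℕ, p.Prime → p ≤ Classical.choose (LargeChar.elnat_largeChar n e) →
      ∀ (k : Type) [Field k] [CharP k p] [IsAlgClosed k] (H : Scheme.{0})
      (ι : H ⟶ (Literature.AlgebraicGeometry.Motives.projectiveSpace n k).left), IsClosedImmersion ι → IsIntegral H →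
      (∀ y : (Literature.AlgebraicGeometry.Motives.projectiveSpace n k).left,
        ∃ U : (Literature.AlgebraicGeometry.Motives.projectiveSpace n k).left.affineOpens,
          y ∈ (U : (Literature.AlgebraicGeometry.Motives.projectiveSpace n k).left.Opens) ∧ (ι.ker.ideal U).IsPrincipal) →
      ¬ Scheme.IsRegular H → ∀ F : MvPolynomial (Fin (n + 1)) k, F.IsHomogeneous e → Prime F →
      (letI := MvPolynomial.gradedAlgebra (σ := Fin (n + 1)) (R := k)
       Set.range ι = {x : Proj (homogeneousSubmodule (Fin (n + 1)) k) | F ∈ x.asHomogeneousIdeal}) →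
      ELNatConclusionO k n H ι) :
    Summit.ResolutionOfSingularities.ResolutionOfSingularities.Theses.EquisingularLift.EquisingularLiftNat := by
  refine equisingularLiftNat_of_forall_elnatO_primeForms ?_
  intro p hp k _ _ _ n H ι hι hH hloc hn hreg e F he hF hprime hrange
  by_cases hp' : p ≤ Classical.choose (LargeChar.elnat_largeChar n e)
  · exact h n e hn he p hp hp' k H ι hι hH hloc hreg F hF hprime hrange
  · exact Classical.choose_spec (LargeChar.elnat_largeChar n e) p hp k (lt_of_not_ge hp') H ι F hF
      ⟨hH, hprime.ne_zero, hrange⟩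

/-- ★★ **`Theses.EquisingularLift.EquisingularLiftNatThree` (stmt-…-20148): PER DEGREE, ONLY FINITELY MANY CHARACTERISTICS REMAIN.**  With
`M(3, e) := Classical.choose (LargeChar.elnat_largeChar 3 e)`: if for every degree `e ≥ 2`, every prime `p ≤ M(3, e)`, every algebraically closed `k`
of characteristic `p` and every NON-REGULAR integral SURFACE `H`, `range ι = V₊(F) ⊂ ℙ³_k`, `F` a PRIME quaternary form of degree `e` (crux hypotheses),
the stubs' conclusion `ELNatConclusionO k 3 H ι` holds — then the route decl holds BY NAME (large `p`: ✓ `LargeChar.elnat_largeChar`; the rest: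
✓ `equisingularLiftNatThree_of_forall_elnatO_primeForms`). [OURS · DEF-FREE · pure reduction over ✓ RUNG LC; `M` ineffective] -/
theorem equisingularLiftNatThree_of_forall_elnatO_smallChar
    (h : ∀ (e : ℕ), 2 ≤ e → ∀ p : ℕ, p.Prime → p ≤ Classical.choose (LargeChar.elnat_largeChar 3 e) →
      ∀ (k : Type) [Field k] [CharP k p] [IsAlgClosed k] (H : Scheme.{0})
      (ι : H ⟶ (Literature.AlgebraicGeometry.Motives.projectiveSpace 3 k).left), IsClosedImmersion ι → IsIntegral H →
      (∀ y : (Literature.AlgebraicGeometry.Motives.projectiveSpace 3 k).left,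
        ∃ U : (Literature.AlgebraicGeometry.Motives.projectiveSpace 3 k).left.affineOpens,
          y ∈ (U : (Literature.AlgebraicGeometry.Motives.projectiveSpace 3 k).left.Opens) ∧ (ι.ker.ideal U).IsPrincipal) →
      ¬ Scheme.IsRegular H → ∀ F : MvPolynomial (Fin (3 + 1)) k, F.IsHomogeneous e → Prime F →
      (letI := MvPolynomial.gradedAlgebra (σ := Fin (3 + 1)) (R := k)
       Set.range ι = {x : Proj (homogeneousSubmodule (Fin (3 + 1)) k) | F ∈ x.asHomogeneousIdeal}) →
      ELNatConclusionO k 3 H ι) :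
    Summit.ResolutionOfSingularities.ResolutionOfSingularities.Theses.EquisingularLift.EquisingularLiftNatThree := by
  refine equisingularLiftNatThree_of_forall_elnatO_primeForms ?_
  intro p hp k _ _ _ n H ι hι hH hloc hn hreg e F he hF hprime hrange
  subst hn
  by_cases hp' : p ≤ Classical.choose (LargeChar.elnat_largeChar 3 e)
  · exact h e he p hp hp' k H ι hι hH hloc hreg F hF hprime hrange
  · exact Classical.choose_spec (LargeChar.elnat_largeChar 3 e) p hp k (lt_of_not_ge hp') H ι F hF
      ⟨hH, hprime.ne_zero, hrange⟩

end RouteCurrency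

end Summit.ResolutionOfSingularities.ResolutionOfSingularities.Cruxes.EquisingularLiftNat.Sections

namespace Summit.ResolutionOfSingularities.ResolutionOfSingularities.Cruxes.EquisingularLift.StrataSplit

open Summit.ResolutionOfSingularities.ResolutionOfSingularities.Cruxes.EquisingularLiftNat.Sections

/-- ★★ **`Theses.EquisingularLift.EquisingularLift` (stmt-…-15660): PER DEGREE, ONLY FINITELY MANY CHARACTERISTICS REMAIN.**  From the hypothesis
of `RouteCurrency.equisingularLiftNat_of_forall_elnatO_smallChar` (the stubs' conclusion at non-regular prime-form hypersurfaces of degree `e ≥ 2` in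
`ℙⁿ`, `n ≥ 3`, in characteristics `p ≤ M(n, e)` only) the route decl `EquisingularLift` holds BY NAME: EL♮ at `p` ⇒ EL at `p`, instance by instance
(✓ `EquisingularLiftNatBands.elConclusion_of_natConclusion`). [OURS · DEF-FREE · pure reduction over ✓ RUNG LC; `M` ineffective] -/
theorem equisingularLift_of_forall_elnatO_smallChar
    (h : ∀ (n e : ℕ), 3 ≤ n → 2 ≤ e → ∀ p : ℕ, p.Prime → p ≤ Classical.choose (LargeChar.elnat_largeChar n e) →
      ∀ (k : Type) [Field k] [CharP k p] [IsAlgClosed k] (H : Scheme.{0})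
      (ι : H ⟶ (Literature.AlgebraicGeometry.Motives.projectiveSpace n k).left), IsClosedImmersion ι → IsIntegral H →
      (∀ y : (Literature.AlgebraicGeometry.Motives.projectiveSpace n k).left,
        ∃ U : (Literature.AlgebraicGeometry.Motives.projectiveSpace n k).left.affineOpens,
          y ∈ (U : (Literature.AlgebraicGeometry.Motives.projectiveSpace n k).left.Opens) ∧ (ι.ker.ideal U).IsPrincipal) →
      ¬ Scheme.IsRegular H → ∀ F : MvPolynomial (Fin (n + 1)) k, F.IsHomogeneous e → Prime F →
      (letI := MvPolynomial.gradedAlgebra (σ := Fin (n + 1)) (R := k)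
       Set.range ι = {x : Proj (homogeneousSubmodule (Fin (n + 1)) k) | F ∈ x.asHomogeneousIdeal}) →
      ELNatConclusionO k n H ι) :
    Summit.ResolutionOfSingularities.ResolutionOfSingularities.Theses.EquisingularLift.EquisingularLift :=
  fun p hp k _ _ _ n H ι hι hH hloc =>
    EquisingularLiftNatBands.elConclusion_of_natConclusion p k n H ι hι hH
      (RouteCurrency.equisingularLiftNat_of_forall_elnatO_smallChar h p hp k n H ι hι hH hloc)

end Summit.ResolutionOfSingularities.ResolutionOfSingularities.Cruxes.EquisingularLift.StrataSplit

end
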